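import Literature.Probability.Percolation.QuadCrossingSpaceProofs
import HarnessLib

/-!
# The perturbations `Q^{q_{∓s}}` of a quad: `Q₋(s) < Q₀ < Q₊(s)` (Schramm–Smirnov, proof of Lemma 5.1)

Topic `Probability/Percolation`; second proofs file next to `QuadCrossingSpaceProofs.lean`, towards
the named fact `SchrammSmirnov2011_lemma_5_1` (`QuadCrossingContinuityEvents.lean`).  In the proof
of Lemma 5.1 (O. Schramm, S. Smirnov, *On the scaling limits of planar percolation*, Ann. Probab.
39 (2011), arXiv:1101.5820, p. 21) a quad `Q₀` is extended to a continuous injection `Q̂₀` of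
`[-1, 2]²` and perturbed inside this extension: `Q^q(x, y) = Q̂₀(x₀ + (x₁ - x₀)x, y₀ + (y₁ - y₀)y)`,
and for `q_s = (-s, s, 1 + s, 1 - s)` one has `Q' := Q^{q_{-s}} < Q₀ < Q'' := Q^{q_s}` — `Q'` is the
image of a taller-and-narrower rectangle, `Q''` of a wider-and-shorter one.

`QuadCrossingSpaceProofs.lean` proves the half `Q' < Q₀` (inside `Quad.exists_strictlyDominated_dist_lt`,
enough for condition `(3.2)`), reading `Q₀` through the affine chart `(x, y) ↦ (2x-1) + (2y-1)i` of
the square `[-1, 1]²` and an extension `H : ℂ ≃ₜ ℂ` (`Quad.exists_homeomorph_extend`, Schoenflies),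
with `Q' = H ∘ A_s ∘ chart`, `A_s(x + iy) = (1-s)x + i(1+s)y`.  This file delivers BOTH halves, for
ALL small `s` and in explicit form, as the route to Lemma 5.1 needs them (the percolation estimate
(5.1) is about these very quads):

* `Quad.exists_perturbations` — for `D` open and `Q₀ ∈ 𝒬_D` there are `H : ℂ ≃ₜ ℂ` through which
  `Q₀` is the chart of the square, and `t₀ ∈ (0, 1/2]`, such that for every `0 < t ≤ t₀` the maps
  `Q₋(t) = H ∘ A_t ∘ chart` and `Q₊(t) = H ∘ A_t⁻¹ ∘ chart` are quads of `D` with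
  `Q₋(t) < Q₀ < Q₊(t)`.  The second half is the first one for the homeomorphism `H ∘ A_t⁻¹`
  (through which `Q₊(t)` is the chart of the square and `Q₀` the chart of the narrow rectangle
  `A_t([-1,1]²)`), both resting on the crossing lemma `Quad.dominated_of_near`.
* `norm_ofReal_add_mul_I_sub_le`, `Quad.norm_stretch_sub_stretch_le`,
  `Quad.unstretchChart_mem_rect` — elementary estimates (`A_t` is `2`-Lipschitz, the stretched
  chart points stay in `[-2, 2]²`).

## References

* O. Schramm, S. Smirnov, Ann. Probab. 39 (2011) 1768–1814, arXiv:1101.5820, proof of Lemma 5.1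
  (the quads `Q^q`, `Q' < Q₀ < Q''`) and §3 (3.2). [SchrammSmirnov2011]
-/

noncomputable section

open scoped unitInterval
open Set Filter Metric Function Complex
open _root_.Topology
open Literature.Topology.PlaneTopology Literature.Probability.RandomPlanarGeometry

namespace Literature.Probability.Percolation

namespace QuadCrossing

variable {D : Set ℂ}

/-- `‖(u + vi) - (u' + v'i)‖ ≤ |u - u'| + |v - v'|` for real `u, v, u', v'`. [folklore] -/
theorem norm_ofReal_add_mul_I_sub_le (u v u' v' : ℝ) :
    ‖((u : ℂ) + (v : ℂ) * Complex.I) - ((u' : ℂ) + (v' : ℂ) * Complex.I)‖ ≤ |u - u'| + |v - v'| := by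
  have h : ((u : ℂ) + (v : ℂ) * Complex.I) - ((u' : ℂ) + (v' : ℂ) * Complex.I) =
      ((u - u' : ℝ) : ℂ) + ((v - v' : ℝ) : ℂ) * Complex.I := by
    push_cast; ring
  rw [h]
  calc ‖((u - u' : ℝ) : ℂ) + ((v - v' : ℝ) : ℂ) * Complex.I‖
      ≤ ‖((u - u' : ℝ) : ℂ)‖ + ‖((v - v' : ℝ) : ℂ) * Complex.I‖ := norm_add_le _ _
    _ = |u - u'| + |v - v'| := by
        rw [norm_mul, norm_I, mul_one, norm_real, norm_real, Real.norm_eq_abs, Real.norm_eq_abs]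

namespace Quad

/-- The stretch `A_t (x + iy) = (1-t)x + i(1+t)y` is `2`-Lipschitz for `0 ≤ t ≤ 1`. [folklore] -/
theorem norm_stretch_sub_stretch_le {t : ℝ} (ht : 0 ≤ t) (ht1 : t ≤ 1) (a b : ℂ) :
    ‖((((1 - t) * a.re : ℝ) : ℂ) + (((1 + t) * a.im : ℝ) : ℂ) * Complex.I) -
        ((((1 - t) * b.re : ℝ) : ℂ) + (((1 + t) * b.im : ℝ) : ℂ) * Complex.I)‖ ≤ 2 * ‖a - b‖ := by
  refine (norm_ofReal_add_mul_I_sub_le _ _ _ _).trans ?_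
  rw [← mul_sub, ← mul_sub, abs_mul, abs_mul, abs_of_nonneg (by linarith : (0 : ℝ) ≤ 1 - t),
    abs_of_nonneg (by linarith : (0 : ℝ) ≤ 1 + t), ← sub_re, ← sub_im]
  have h1 := abs_re_le_norm (a - b)
  have h2 := abs_im_le_norm (a - b)
  nlinarith [norm_nonneg (a - b)]

/-- The un-stretched chart point `(2x-1)/(1-t) + i(2y-1)/(1+t)` of `p = (x, y) ∈ [0,1]²` lies in
`[-2, 2]²` for `0 ≤ t ≤ 1/2`. [folklore] -/
theorem unstretchChart_mem_rect {t : ℝ} (ht : 0 ≤ t) (ht' : t ≤ 1 / 2) (p : I × I) :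
    ((((2 * (p.1 : ℝ) - 1) / (1 - t) : ℝ) : ℂ) + (((2 * (p.2 : ℝ) - 1) / (1 + t) : ℝ) : ℂ) * Complex.I) ∈
      Icc (-2 : ℝ) 2 ×ℂ Icc (-2 : ℝ) 2 := by
  rw [mem_reProdIm, mem_Icc, mem_Icc, (re_im_ofReal_add_ofReal_mul_I _ _).1,
    (re_im_ofReal_add_ofReal_mul_I _ _).2]
  have h1 := p.1.2; have h2 := p.2.2
  simp only [mem_Icc] at h1 h2
  have ha : (0 : ℝ) < 1 - t := by linarith
  have hb : (0 : ℝ) < 1 + t := by linarith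
  refine ⟨⟨?_, ?_⟩, ⟨?_, ?_⟩⟩
  · rw [le_div_iff₀ ha]; linarith
  · rw [div_le_iff₀ ha]; linarith
  · rw [le_div_iff₀ hb]; linarith
  · rw [div_le_iff₀ hb]; linarith

/-- **The perturbations `Q₋(t) < Q₀ < Q₊(t)` of a quad** (Schramm–Smirnov's `Q' = Q^{q_{-s}}`,
`Q'' = Q^{q_s}` in the proof of Lemma 5.1).  For `D ⊆ ℂ` open and `Q₀ ∈ 𝒬_D` there are a
homeomorphism `H` of the plane with `H((2x-1) + (2y-1)i) = Q₀(x, y)` and `t₀ ∈ (0, 1/2]` such that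
for all `0 < t ≤ t₀`: `Q₋(t)(x, y) = H((1-t)(2x-1) + i(1+t)(2y-1))` (the image of the taller and
narrower rectangle `[-(1-t), 1-t] × [-(1+t), 1+t]`) and
`Q₊(t)(x, y) = H((2x-1)/(1-t) + i(2y-1)/(1+t))` (the image of the wider and shorter rectangle
`[-1/(1-t), 1/(1-t)] × [-1/(1+t), 1/(1+t)]`) are quads of `D`, and `Q₋(t) < Q₀ < Q₊(t)`.
Proof: `H` from `exists_homeomorph_extend`; membership in `D` for small `t` by uniform continuity
of `H` on `[-2, 2]²`; `Q₋(t) < Q₀` by `dominated_of_near H` on balls of a radius given by uniform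
continuity of `H⁻¹`, and `Q₀ < Q₊(t)` by `dominated_of_near (H ∘ A_t⁻¹)`, through which `Q₊(t)` is
the chart of the square and `Q₀` that of `A_t([-1, 1]²)` (`A_t` is `2`-Lipschitz).
[cite: SchrammSmirnov2011, proof of Lemma 5.1] -/
theorem exists_perturbations (hD : IsOpen D) (Q : Quad D) :
    ∃ H : ℂ ≃ₜ ℂ,
      (∀ p : I × I,
        H (((2 * (p.1 : ℝ) - 1 : ℝ) : ℂ) + ((2 * (p.2 : ℝ) - 1 : ℝ) : ℂ) * Complex.I) = Q p) ∧
      ∃ t₀ : ℝ, 0 < t₀ ∧ t₀ ≤ 1 / 2 ∧ ∀ t : ℝ, 0 < t → t ≤ t₀ →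
        ∃ Qm Qp : Quad D,
          (∀ p : I × I, Qm p = H ((((1 - t) * (2 * (p.1 : ℝ) - 1) : ℝ) : ℂ) +
            (((1 + t) * (2 * (p.2 : ℝ) - 1) : ℝ) : ℂ) * Complex.I)) ∧
          (∀ p : I × I, Qp p = H ((((2 * (p.1 : ℝ) - 1) / (1 - t) : ℝ) : ℂ) +
            (((2 * (p.2 : ℝ) - 1) / (1 + t) : ℝ) : ℂ) * Complex.I)) ∧
          StrictlyDominated Qm Q ∧ StrictlyDominated Q Qp := by
  obtain ⟨H, hH⟩ := exists_homeomorph_extend Q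
  refine ⟨H, hH, ?_⟩
  -- room in `D` around `[Q]`
  obtain ⟨δD, hδD, hthick⟩ :=
    Q.isCompact_carrier.exists_cthickening_subset_open hD Q.carrier_subset
  -- uniform continuity of `H` on `C = [-2, 2]²`
  set C := Icc (-2 : ℝ) 2 ×ℂ Icc (-2 : ℝ) 2 with hC
  have hCc : IsCompact C := isCompact_rect 2 2
  obtain ⟨δ, hδ, hHδ⟩ := Metric.uniformContinuousOn_iff.1
    (hCc.uniformContinuousOn_of_continuous H.continuous.continuousOn) δD hδD
  refine ⟨min (1 / 2) (δ / 4), lt_min (by norm_num) (by linarith), min_le_left _ _,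
    fun t ht ht₀ => ?_⟩
  have ht' : t ≤ 1 / 2 := ht₀.trans (min_le_left _ _)
  have htδ : 4 * t ≤ δ := by
    have := ht₀.trans (min_le_right (1 / 2 : ℝ) (δ / 4))
    linarith
  have ht1 : t ≤ 1 := by linarith
  have ha : (0 : ℝ) < 1 - t := by linarith
  have hb : (0 : ℝ) < 1 + t := by linarith
  -- chart points, stretched and un-stretched chart points lie in `C`
  have hchartC : ∀ p : I × I,
      (((2 * (p.1 : ℝ) - 1 : ℝ) : ℂ) + ((2 * (p.2 : ℝ) - 1 : ℝ) : ℂ) * Complex.I) ∈ C := fun p => by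
    have h := chart_mem_rect p
    rw [mem_reProdIm, mem_Icc, mem_Icc] at h
    rw [hC, mem_reProdIm, mem_Icc, mem_Icc]
    exact ⟨⟨by linarith [h.1.1], by linarith [h.1.2]⟩, ⟨by linarith [h.2.1], by linarith [h.2.2]⟩⟩
  have hshrinkC : ∀ p : I × I, ((((1 - t) * (2 * (p.1 : ℝ) - 1) : ℝ) : ℂ) +
      (((1 + t) * (2 * (p.2 : ℝ) - 1) : ℝ) : ℂ) * Complex.I) ∈ C := fun p =>
    shrinkChart_mem_rect ht.le ht1 p
  have hunstrC : ∀ p : I × I, ((((2 * (p.1 : ℝ) - 1) / (1 - t) : ℝ) : ℂ) +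
      (((2 * (p.2 : ℝ) - 1) / (1 + t) : ℝ) : ℂ) * Complex.I) ∈ C := fun p =>
    unstretchChart_mem_rect ht.le ht' p
  -- both perturbations move chart points by less than `δ`
  have hcoord : ∀ p : I × I, |2 * (p.1 : ℝ) - 1| ≤ 1 ∧ |2 * (p.2 : ℝ) - 1| ≤ 1 := fun p => by
    have h1 := p.1.2; have h2 := p.2.2
    simp only [mem_Icc] at h1 h2
    exact ⟨abs_le.2 ⟨by linarith, by linarith⟩, abs_le.2 ⟨by linarith, by linarith⟩⟩
  have hmove₁ : ∀ p : I × I, dist ((((1 - t) * (2 * (p.1 : ℝ) - 1) : ℝ) : ℂ) +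
      (((1 + t) * (2 * (p.2 : ℝ) - 1) : ℝ) : ℂ) * Complex.I)
      (((2 * (p.1 : ℝ) - 1 : ℝ) : ℂ) + ((2 * (p.2 : ℝ) - 1 : ℝ) : ℂ) * Complex.I) < δ := fun p => by
    rw [dist_eq_norm]
    refine (norm_ofReal_add_mul_I_sub_le _ _ _ _).trans_lt ?_
    have e1 : (1 - t) * (2 * (p.1 : ℝ) - 1) - (2 * (p.1 : ℝ) - 1) = -(t * (2 * (p.1 : ℝ) - 1)) := by
      ring
    have e2 : (1 + t) * (2 * (p.2 : ℝ) - 1) - (2 * (p.2 : ℝ) - 1) = t * (2 * (p.2 : ℝ) - 1) := by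
      ring
    rw [e1, e2, abs_neg, abs_mul, abs_mul, abs_of_pos ht]
    nlinarith [(hcoord p).1, (hcoord p).2, abs_nonneg (2 * (p.1 : ℝ) - 1),
      abs_nonneg (2 * (p.2 : ℝ) - 1)]
  have hmove₂ : ∀ p : I × I, dist ((((2 * (p.1 : ℝ) - 1) / (1 - t) : ℝ) : ℂ) +
      (((2 * (p.2 : ℝ) - 1) / (1 + t) : ℝ) : ℂ) * Complex.I)
      (((2 * (p.1 : ℝ) - 1 : ℝ) : ℂ) + ((2 * (p.2 : ℝ) - 1 : ℝ) : ℂ) * Complex.I) < δ := fun p => by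
    rw [dist_eq_norm]
    refine (norm_ofReal_add_mul_I_sub_le _ _ _ _).trans_lt ?_
    have e1 : (2 * (p.1 : ℝ) - 1) / (1 - t) - (2 * (p.1 : ℝ) - 1) =
        (2 * (p.1 : ℝ) - 1) * (t / (1 - t)) := by
      field_simp
      ring
    have e2 : (2 * (p.2 : ℝ) - 1) / (1 + t) - (2 * (p.2 : ℝ) - 1) =
        -((2 * (p.2 : ℝ) - 1) * (t / (1 + t))) := by
      field_simp
      ring
    have hq1 : t / (1 - t) ≤ 2 * t := by
      rw [div_le_iff₀ ha]; nlinarith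
    have hq2 : t / (1 + t) ≤ t := by
      rw [div_le_iff₀ hb]; nlinarith
    have hq1' : 0 ≤ t / (1 - t) := div_nonneg ht.le ha.le
    have hq2' : 0 ≤ t / (1 + t) := div_nonneg ht.le hb.le
    rw [e1, e2, abs_neg, abs_mul, abs_mul, abs_of_nonneg hq1', abs_of_nonneg hq2']
    nlinarith [(hcoord p).1, (hcoord p).2, abs_nonneg (2 * (p.1 : ℝ) - 1),
      abs_nonneg (2 * (p.2 : ℝ) - 1)]
  have hclose₁ : ∀ p : I × I, dist (H ((((1 - t) * (2 * (p.1 : ℝ) - 1) : ℝ) : ℂ) +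
      (((1 + t) * (2 * (p.2 : ℝ) - 1) : ℝ) : ℂ) * Complex.I)) (Q p) < δD := fun p => by
    rw [← hH p]
    exact hHδ _ (hshrinkC p) _ (hchartC p) (hmove₁ p)
  have hclose₂ : ∀ p : I × I, dist (H ((((2 * (p.1 : ℝ) - 1) / (1 - t) : ℝ) : ℂ) +
      (((2 * (p.2 : ℝ) - 1) / (1 + t) : ℝ) : ℂ) * Complex.I)) (Q p) < δD := fun p => by
    rw [← hH p]
    exact hHδ _ (hunstrC p) _ (hchartC p) (hmove₂ p)
  -- the two perturbed quads
  let Qm : Quad D :=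
    { toFun := fun p => H ((((1 - t) * (2 * (p.1 : ℝ) - 1) : ℝ) : ℂ) +
        (((1 + t) * (2 * (p.2 : ℝ) - 1) : ℝ) : ℂ) * Complex.I)
      continuous_toFun := by fun_prop
      injective_toFun := by
        intro p q hpq
        have h := ofReal_add_ofReal_mul_I_inj (H.injective hpq)
        have h1 : (p.1 : ℝ) = q.1 := by
          have := mul_left_cancel₀ ha.ne' h.1
          linarith
        have h2 : (p.2 : ℝ) = q.2 := by
          have := mul_left_cancel₀ hb.ne' h.2
          linarith
        exact Prod.ext (Subtype.ext h1) (Subtype.ext h2)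
      range_subset := by
        rintro _ ⟨p, rfl⟩
        exact hthick (mem_cthickening_of_dist_le _ (Q p) _ _ ⟨p, rfl⟩ (hclose₁ p).le) }
  let Qp : Quad D :=
    { toFun := fun p => H ((((2 * (p.1 : ℝ) - 1) / (1 - t) : ℝ) : ℂ) +
        (((2 * (p.2 : ℝ) - 1) / (1 + t) : ℝ) : ℂ) * Complex.I)
      continuous_toFun := by fun_prop
      injective_toFun := by
        intro p q hpq
        have h := ofReal_add_ofReal_mul_I_inj (H.injective hpq)
        have h1 : (p.1 : ℝ) = q.1 := by
          have := h.1
          rw [div_left_inj' ha.ne'] at this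
          linarith
        have h2 : (p.2 : ℝ) = q.2 := by
          have := h.2
          rw [div_left_inj' hb.ne'] at this
          linarith
        exact Prod.ext (Subtype.ext h1) (Subtype.ext h2)
      range_subset := by
        rintro _ ⟨p, rfl⟩
        exact hthick (mem_cthickening_of_dist_le _ (Q p) _ _ ⟨p, rfl⟩ (hclose₂ p).le) }
  refine ⟨Qm, Qp, fun p => rfl, fun p => rfl, ?_⟩
  -- uniform continuity of `H⁻¹` on a compact neighbourhood of `H(C)`
  set N := cthickening 1 (H '' C) with hN
  have hNc : IsCompact N := (hCc.image H.continuous).cthickening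
  set η : ℝ := t / 8 with hη_def
  have hη : 0 < η := by positivity
  have hηs : 4 * η < t := by rw [hη_def]; linarith
  obtain ⟨δ', hδ', hHδ'⟩ := Metric.uniformContinuousOn_iff.1
    (hNc.uniformContinuousOn_of_continuous H.symm.continuous.continuousOn) (η / 2) (by positivity)
  set r : ℝ := min 1 δ' with hr_def
  have hr : 0 < r := lt_min one_pos hδ'
  have hr1 : r ≤ 1 := min_le_left _ _
  have hrδ : r ≤ δ' := min_le_right _ _
  have key : ∀ x z : ℂ, z ∈ C → dist x (H z) < r → ‖H.symm x - z‖ ≤ η / 2 := by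
    intro x z hz hxz
    have hHz : H z ∈ N := self_subset_cthickening _ (mem_image_of_mem H hz)
    have hx : x ∈ N := mem_cthickening_of_dist_le x (H z) 1 _ (mem_image_of_mem H hz)
      (hxz.le.trans hr1)
    have := hHδ' x hx (H z) hHz (hxz.trans_le hrδ)
    rw [H.symm_apply_apply, dist_eq_norm] at this
    exact this.le
  have hη2 : η / 2 ≤ η := half_le_self hη.le
  constructor
  · -- `Q₋(t) < Q₀`
    refine strictlyDominated_iff.2 ⟨ball Qm r, ball Q r, isOpen_ball, isOpen_ball,
      mem_ball_self hr, mem_ball_self hr, fun P hP P' hP' => ?_⟩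
    refine dominated_of_near H ht' hη hηs (fun p => ?_) (fun p => ?_)
    · refine (key _ _ (hchartC p) ?_).trans hη2
      rw [hH p]
      exact (dist_apply_le P' Q p).trans_lt (mem_ball.1 hP')
    · refine (key _ _ (hshrinkC p) ?_).trans hη2
      exact (dist_apply_le P Qm p).trans_lt (mem_ball.1 hP)
  · -- `Q₀ < Q₊(t)`, through `H' = H ∘ A_t⁻¹`
    let A : ℂ ≃ₜ ℂ :=
      { toFun := fun z => ((((1 - t) * z.re : ℝ)) : ℂ) + ((((1 + t) * z.im : ℝ)) : ℂ) * Complex.I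
        invFun := fun z => (((z.re / (1 - t) : ℝ)) : ℂ) + (((z.im / (1 + t) : ℝ)) : ℂ) * Complex.I
        left_inv := fun z => by
          apply Complex.ext
          · rw [(re_im_ofReal_add_ofReal_mul_I _ _).1, (re_im_ofReal_add_ofReal_mul_I _ _).1,
              mul_div_cancel_left₀ _ ha.ne']
          · rw [(re_im_ofReal_add_ofReal_mul_I _ _).2, (re_im_ofReal_add_ofReal_mul_I _ _).2,
              mul_div_cancel_left₀ _ hb.ne']
        right_inv := fun z => by
          apply Complex.ext
          · rw [(re_im_ofReal_add_ofReal_mul_I _ _).1, (re_im_ofReal_add_ofReal_mul_I _ _).1,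
              mul_div_cancel₀ _ ha.ne']
          · rw [(re_im_ofReal_add_ofReal_mul_I _ _).2, (re_im_ofReal_add_ofReal_mul_I _ _).2,
              mul_div_cancel₀ _ hb.ne']
        continuous_toFun := by fun_prop
        continuous_invFun := by fun_prop }
    have hAapply : ∀ z : ℂ,
        A z = ((((1 - t) * z.re : ℝ)) : ℂ) + ((((1 + t) * z.im : ℝ)) : ℂ) * Complex.I := fun z => rfl
    set H' : ℂ ≃ₜ ℂ := A.symm.trans H with hH'
    have hH'symm : ∀ w, H'.symm w = A (H.symm w) := fun w => by
      rw [hH', Homeomorph.symm_trans_apply, Homeomorph.symm_symm]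
    have hAchart : ∀ p : I × I,
        A (((2 * (p.1 : ℝ) - 1 : ℝ) : ℂ) + ((2 * (p.2 : ℝ) - 1 : ℝ) : ℂ) * Complex.I) =
          ((((1 - t) * (2 * (p.1 : ℝ) - 1) : ℝ) : ℂ) +
            (((1 + t) * (2 * (p.2 : ℝ) - 1) : ℝ) : ℂ) * Complex.I) := fun p => by
      rw [hAapply, (re_im_ofReal_add_ofReal_mul_I _ _).1, (re_im_ofReal_add_ofReal_mul_I _ _).2]
    have hAunstr : ∀ p : I × I,
        A ((((2 * (p.1 : ℝ) - 1) / (1 - t) : ℝ) : ℂ) +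
            (((2 * (p.2 : ℝ) - 1) / (1 + t) : ℝ) : ℂ) * Complex.I) =
          (((2 * (p.1 : ℝ) - 1 : ℝ) : ℂ) + ((2 * (p.2 : ℝ) - 1 : ℝ) : ℂ) * Complex.I) := fun p => by
      rw [hAapply, (re_im_ofReal_add_ofReal_mul_I _ _).1, (re_im_ofReal_add_ofReal_mul_I _ _).2,
        mul_div_cancel₀ _ ha.ne', mul_div_cancel₀ _ hb.ne']
    refine strictlyDominated_iff.2 ⟨ball Q r, ball Qp r, isOpen_ball, isOpen_ball,
      mem_ball_self hr, mem_ball_self hr, fun P hP P' hP' => ?_⟩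
    refine dominated_of_near H' ht' hη hηs (fun p => ?_) (fun p => ?_)
    · -- `P'` near `Q₊(t)`: `H'⁻¹ ∘ P'` is near the chart of the square
      rw [hH'symm, ← hAunstr p, hAapply, hAapply]
      refine (norm_stretch_sub_stretch_le ht.le ht1 _ _).trans ?_
      have hk := key (P' p) _ (hunstrC p) ((dist_apply_le P' Qp p).trans_lt (mem_ball.1 hP'))
      linarith
    · -- `P` near `Q₀`: `H'⁻¹ ∘ P` is near the chart of the narrow rectangle `A_t([-1,1]²)`
      rw [hH'symm, ← hAchart p, hAapply, hAapply]
      refine (norm_stretch_sub_stretch_le ht.le ht1 _ _).trans ?_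
      have hk := key (P p) _ (hchartC p) (by
        rw [hH p]
        exact (dist_apply_le P Q p).trans_lt (mem_ball.1 hP))
      linarith

end Quad

end QuadCrossing

end Literature.Probability.Percolation
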